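import Mathlib
import HarnessLib
import Literature.MathematicalPhysics.QuantumLattice.TorusCooperSumFermiLevel
import Literature.MathematicalPhysics.QuantumLattice.TorusBandIntegratedDensity
import Summits.HubbardSuperconductivity.HubbardSuperconductivity.Theorems.WeakCouplingBCSWcbcsBcsConstructionFreeLevelCountsWindow

/-!
# Crux `WcbcsBcsConstruction` (stmt-HubbardSuperconductivity-2010), line `ladder-scale-certified-chain`:
# stub (T1) `stub_freeLevelCountsOuter` — free level counts at the two OUTER energies of the window

For all large `L`, the free level counts `torusLevelCount L E = #{k ∈ (ℤ/Lℤ)² : ε_L(k) ≤ E}` of the torus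
band `ε_L(k) = -2(cos(2πk₀/L) + cos(2πk₁/L))` satisfy `2·#{ε_L ≤ -23/25} ≥ 0.61·L²` and
`2·#{ε_L ≤ -3/10} ≤ 0.88·L²` (registered signature `stub_freeLevelCountsOuter`; the certified free-gas
input of the thin summit-level composition, stub (T2)). PROOF (verbatim the pattern of the landed stub (D1b)
`stub_freeLevelCountsWindow`): by the tree's Weyl law (`tendsto_torusLevelCount_div_sq`) it suffices to
certify `N(-23/25) > 61/200` and `N(-3/10) < 22/50` for the integrated density of states
`N(E) = vol {v ∈ [0,1)² | -2(cos 2πv₀ + cos 2πv₁) ≤ E}` (numerically `0.3105`, `0.4355`). These follow from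
the staircase-from-table bounds `volume_real_sublevelCell_le_of_table` / `le_volume_real_sublevelCell_of_table`
of `…FreeLevelCountsWindow.lean` on `60` uniform rows with two explicit tables of box widths (units `10⁻⁴`,
folded by the symmetry `j ↦ 59 - j`): the `120` row inequalities are checked in exact rational arithmetic by
`decide` (kernel) against the certified rational polynomial cosine bounds `cos_two_pi_mul_le_ratPoly`,
`ratPoly_le_cos_two_pi_mul`, giving `N(-3/10) ≤ 131428/300000 = 0.43809…` and
`N(-23/25) ≥ 92618/300000 = 0.30872…`.
References: Weyl law / lattice-point counting (folklore); band convention Benfatto–Giuliani–Mastropietro,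
AHP 7 (2006) 809, eq. (1.4).
-/

noncomputable section

-- the tree's namespace `Summit.<Summit>.<Problem>.Theorems` repeats the summit name by design (D-0017)
set_option linter.dupNamespace false

namespace Summit.HubbardSuperconductivity.HubbardSuperconductivity.Theorems

open MeasureTheory Finset Filter Topology
open Literature.MathematicalPhysics.QuantumLattice Literature.Probability.LatticeModels

/-! ### The two tables and the certified bounds at the outer energies -/

/-- **`N(-3/10) ≤ 131428/300000 (= 0.43809…)`**: circumscribed staircase of `60` rows for `m = 3/20`
with the box widths below (units `10⁻⁴`, folded by `j ↦ 59 - j`); the `60` row inequalities and the sum are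
checked by the kernel in exact rational arithmetic. [folklore] -/
theorem volume_real_sublevelCell_outerHi_le :
    volume.real {v : Fin 2 → ℝ | (∀ i, v i ∈ Set.Ico (0 : ℝ) 1) ∧
        -2 * ∑ i : Fin 2, Real.cos (2 * Real.pi * v i) ≤ -(3 : ℝ) / 10} ≤ 131428 / 300000 := by
  have h := volume_real_sublevelCell_le_of_table cos_two_pi_mul_le_ratPoly (K := 30) (Q := 10000)
    (m := 3 / 20) (E := -(3 : ℝ) / 10) (S := 131428) (by norm_num) (by norm_num)
    (by push_cast; norm_num)
    (fun j : ℕ => [4117, 4101, 4054, 3979, 3883, 3771, 3646, 3511, 3369, 3222, 3070, 2914, 2755,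
      2593, 2428, 2261, 2091, 1918, 1742, 1561, 1374, 1180, 973, 743, 458, 0, 0, 0, 0, 0].getD
        (min j (59 - j)) 0)
    (by decide +kernel) (by decide +kernel)
  refine h.trans (le_of_eq ?_)
  norm_num

/-- **`92618/300000 (= 0.30872…) ≤ N(-23/25)`**: inscribed staircase of `60` rows for `m = 23/50` with
the box offsets below (units `10⁻⁴`, folded by `j ↦ 59 - j`), checked by the kernel. [folklore] -/
theorem le_volume_real_sublevelCell_outerLo :
    (92618 : ℝ) / 300000 ≤ volume.real {v : Fin 2 → ℝ | (∀ i, v i ∈ Set.Ico (0 : ℝ) 1) ∧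
        -2 * ∑ i : Fin 2, Real.cos (2 * Real.pi * v i) ≤ -(23 : ℝ) / 25} := by
  have h := le_volume_real_sublevelCell_of_table ratPoly_le_cos_two_pi_mul (K := 30) (Q := 10000)
    (m := 23 / 50) (E := -(23 : ℝ) / 25) (S := 92618) (by norm_num) (by norm_num)
    (by push_cast; norm_num)
    (fun j : ℕ => [3397, 3366, 3316, 3249, 3165, 3067, 2956, 2835, 2703, 2563, 2415, 2258, 2094,
      1921, 1739, 1545, 1335, 1103, 831, 451, 0, 0, 0, 0, 0, 0, 0, 0, 0, 0].getD
        (min j (59 - j)) 0)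
    (by decide +kernel) (by decide +kernel)
  refine le_trans (le_of_eq ?_) h
  norm_num

/-! ### The stub: free level counts at the two outer energies -/

/-- Stub (T1) of the line `ladder-scale-certified-chain` — **free level counts at the two outer energies
of the window.** For all large `L`, `2·#{k ∈ (ℤ/Lℤ)² : ε_L(k) ≤ -23/25} ≥ 0.61·L²` and
`2·#{k : ε_L(k) ≤ -3/10} ≤ 0.88·L²`. Weyl law (`tendsto_torusLevelCount_div_sq`) and the certified
values `N(-23/25) ≥ 0.30872 > 0.305`, `N(-3/10) ≤ 0.43810 < 0.44`. [folklore] -/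
theorem stub_freeLevelCountsOuter :
    ∃ L₁ : ℕ, ∀ L : ℕ, L₁ ≤ L → ∀ [NeZero L],
      (61 / 100 : ℝ) * (L : ℝ) ^ 2 ≤ 2 * (torusLevelCount L (-(23:ℝ) / 25) : ℝ) ∧
      2 * (torusLevelCount L (-(3:ℝ) / 10) : ℝ) ≤ (22 / 25 : ℝ) * (L : ℝ) ^ 2 := by
  have hlo : (61 / 200 : ℝ) < volume.real {v : Fin 2 → ℝ | (∀ i, v i ∈ Set.Ico (0 : ℝ) 1) ∧
      -2 * ∑ i : Fin 2, Real.cos (2 * Real.pi * v i) ≤ -(23 : ℝ) / 25} :=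
    lt_of_lt_of_le (by norm_num) le_volume_real_sublevelCell_outerLo
  have hhi : volume.real {v : Fin 2 → ℝ | (∀ i, v i ∈ Set.Ico (0 : ℝ) 1) ∧
      -2 * ∑ i : Fin 2, Real.cos (2 * Real.pi * v i) ≤ -(3 : ℝ) / 10} < 22 / 50 :=
    lt_of_le_of_lt volume_real_sublevelCell_outerHi_le (by norm_num)
  have h1 := (tendsto_torusLevelCount_div_sq (-(23 : ℝ) / 25)).eventually (lt_mem_nhds hlo)
  have h2 := (tendsto_torusLevelCount_div_sq (-(3 : ℝ) / 10)).eventually (gt_mem_nhds hhi)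
  obtain ⟨N, hN⟩ := Filter.eventually_atTop.1 (h1.and h2)
  refine ⟨N + 1, fun L hL _ => ?_⟩
  obtain ⟨n, rfl⟩ := Nat.exists_eq_add_one_of_ne_zero (n := L) (by omega)
  obtain ⟨h1n, h2n⟩ := hN n (by omega)
  have hpos : (0 : ℝ) < ((n + 1 : ℕ) : ℝ) ^ 2 := by positivity
  rw [lt_div_iff₀ hpos] at h1n
  rw [div_lt_iff₀ hpos] at h2n
  constructor
  · linarith
  · linarith

end Summit.HubbardSuperconductivity.HubbardSuperconductivity.Theorems

end
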